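import Literature.Geometry.Riemannian.SegmentsAreGeodesics
import Literature.Geometry.Riemannian.ExpMapHopfRinow
import Literature.Geometry.Riemannian.CutLocusBishopProofs
import HarnessLib

/-!
# The metric cut locus is the set of cut points `γ_v(t_cut(p, v))`; closedness of the cut locus
reduces to the lower semicontinuity of the cut time (Lee 2018, pp. 307–311)

Layer L6 (metric side) of the programme towards `cutLocus_isClosed_and_mem_of_two_le`
(`CutLocusBishop.lean`), clause (1) "`cutLocus g hg p` is closed". For a smooth Riemannian metric
with geodesically complete Levi-Civita connection on a connected Hausdorff manifold without
boundary, and `p ∈ M` (`γ_v = maximalGeodesic`, `t_cut = cutTime` of `ExponentialMap.lean`,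
`cutLocus` the METRIC cut locus of `CutLocus.lean`):

* `isMinimizingUpTo_iff_edist` — for unit `v`, `γ_v|[0,b]` is minimizing iff `d(p, γ_v(b)) = b`;
  `edist_maximalGeodesic_eq_of_isMinimizingUpTo` — then `d(γ_v(s), γ_v(t)) = |s - t|` on `[0, b]`;
* `isClosed_setOf_isMinimizingUpTo` — the set of `(v, b)` with `γ_v|[0,b]` minimizing is closed
  (continuity of `exp_p` and of `d`); `isMinimizingUpTo_of_cutTime_eq` — the supremum in
  `t_cut` is attained (Lee, Prop. 10.32 (b), first assertion);
* `exists_pos_le_cutTime` — `t_cut(p, ·) ≥ ε > 0` on the unit sphere (normal balls, Prop. 6.11);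
* `eqOn_of_isGeodesic_of_segment` — a geodesic that agrees with a unit-speed metric segment on an
  initial interval agrees with it on the whole segment (`SegmentsAreGeodesics.lean`);
* `exists_unit_cutTime_eq_of_mem_cutLocus`, `maximalGeodesic_mem_cutLocus_of_cutTime_eq` —
  **the metric cut locus of `p` is exactly the set of cut points `γ_v(c)`, `|v|_g = 1`,
  `c = t_cut(p, v) < ∞`** (Lee p. 308: "the cut point of `p` along `γ_v`"; the bridge between the
  metric definition of `CutLocus.lean` and Lee's, via Hopf–Rinow
  `exists_isMinimizingUpTo_of_isGeodesicallyComplete` and "metric segments are geodesics");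
* `isClosed_cutLocus_of_cutTime_le` — **`cutLocus g hg p` is closed provided `t_cut(p, ·)` is
  lower semicontinuous along sequences of unit vectors with finite cut times** — the proof of
  Lee, Thm. 10.34 (a) (p. 311: "`q_i = exp_p(t_cut(v_i) v_i) → q`, a subsequence `v_i → v`,
  continuity of `t_cut` and of `exp`"), with the easy (upper) semicontinuity of `t_cut` proved
  here (`isClosed_setOf_isMinimizingUpTo`) and the lower semicontinuity — the content of Lee's
  Thm. 10.33 resting on Thm. 10.26 (conjugate points, second variation) — kept as the hypothesis.

No definitions and no named facts are introduced (D-0026).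

## References

* J. M. Lee, *Introduction to Riemannian Manifolds*, 2nd ed. (2018), Prop. 6.11, Lemma 6.18,
  Prop. 10.32, Thm. 10.33, Thm. 10.34 (a) (pp. 161, 166, 307–311). [LeeRiemannianManifolds2018]
-/

noncomputable section

open Bundle Set Filter Function Manifold Metric
open scoped Manifold ContDiff Topology ENNReal

namespace Literature.Geometry.Riemannian

open Literature.Geometry.Lorentzian
open Literature.Geometry.Lorentzian.PseudoRiemannianMetric

variable {E : Type*} [NormedAddCommGroup E] [NormedSpace ℝ E] {H : Type*} [TopologicalSpace H]
  {I : ModelWithCorners ℝ E H} {M : Type*} [TopologicalSpace M] [ChartedSpace H M]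
  [IsManifold I ∞ M] {n : ℕ∞ω} [FiniteDimensional ℝ E] [CompleteSpace E] [T2Space M]
  [BoundarylessManifold I M]
  (g : PseudoRiemannianMetric I n E (TangentSpace I : M → Type _)) [g.HasLeviCivita]
  [CovariantDerivative.ContMDiffCovariantDerivative g.leviCivita 1]

/-! ### Minimizing initial segments of unit-speed geodesics -/

/-- For a `g_p`-unit vector `v` on a complete manifold, **`γ_v|[0,b]` is minimizing iff
`d(p, γ_v(b)) = b`** (`γ_v` has length `b` on `[0, b]`, Lee 2018 p. 307).
[cite: LeeRiemannianManifolds2018, pp. 307–308] -/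
theorem isMinimizingUpTo_iff_edist [Fact (1 ≤ n)] (hg : g.IsRiemannian)
    (hc : IsGeodesicallyComplete g.leviCivita) (p : M) {v : E}
    (hv : g.val p (show TangentSpace I p from v) (show TangentSpace I p from v) = 1) (b : ℝ) :
    IsMinimizingUpTo g hg p (show TangentSpace I p from v) b ↔
      g.edist hg p (maximalGeodesic g.leviCivita p (show TangentSpace I p from v) b) =
        ENNReal.ofReal b := by
  have hdom := (maximalGeodesic_of_isGeodesicallyComplete hc p (show TangentSpace I p from v)).1
  have hlen : g.length hg (maximalGeodesic g.leviCivita p (show TangentSpace I p from v)) 0 b =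
      ENNReal.ofReal b := by
    rw [length_maximalGeodesic hg hc p (show TangentSpace I p from v) 0 b, hv, Real.sqrt_one,
      mul_one, sub_zero]
  constructor
  · rintro ⟨-, h⟩
    rw [← h, hlen]
  · intro h
    refine ⟨by rw [hdom]; exact subset_univ _, ?_⟩
    rw [hlen, h]

/-- **A minimizing unit-speed segment realises all distances**: if `γ_v|[0,b]` is minimizing
(`|v|_g = 1`) then `d(γ_v(s), γ_v(t)) = |s - t|` for `s, t ∈ [0, b]` (triangle inequality and
`d ≤ L`). [cite: LeeRiemannianManifolds2018, Prop. 10.32 (a) (proof)] -/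
theorem edist_maximalGeodesic_eq_of_isMinimizingUpTo [Fact (1 ≤ n)] (hg : g.IsRiemannian)
    (hc : IsGeodesicallyComplete g.leviCivita) (p : M) {v : E}
    (hv : g.val p (show TangentSpace I p from v) (show TangentSpace I p from v) = 1) {b : ℝ}
    (hmin : IsMinimizingUpTo g hg p (show TangentSpace I p from v) b) :
    ∀ s ∈ Icc 0 b, ∀ t ∈ Icc 0 b,
      g.edist hg (maximalGeodesic g.leviCivita p (show TangentSpace I p from v) s)
        (maximalGeodesic g.leviCivita p (show TangentSpace I p from v) t) = ENNReal.ofReal |s - t| := by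
  set γ := maximalGeodesic g.leviCivita p (show TangentSpace I p from v) with hγ
  have hγ0 : γ 0 = p :=
    (maximalGeodesic_of_isGeodesicallyComplete hc p (show TangentSpace I p from v)).2.2.1
  -- the case `s ≤ t`
  have key : ∀ s t : ℝ, 0 ≤ s → s ≤ t → t ≤ b → g.edist hg (γ s) (γ t) = ENNReal.ofReal (t - s) := by
    intro s t hs hst htb
    have hb : 0 ≤ b := hs.trans (hst.trans htb)
    have hpb : g.edist hg p (γ b) = ENNReal.ofReal b := (isMinimizingUpTo_iff_edist g hg hc p hv b).1 hmin
    have h1 : g.edist hg (γ s) (γ t) ≤ ENNReal.ofReal (t - s) := edist_maximalGeodesic_le hg hc p hv hst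
    have h2 : g.edist hg p (γ s) ≤ ENNReal.ofReal s := by
      rw [← hγ0, show ENNReal.ofReal s = ENNReal.ofReal (s - 0) by rw [sub_zero]]
      exact edist_maximalGeodesic_le hg hc p hv hs
    have h3 : g.edist hg (γ t) (γ b) ≤ ENNReal.ofReal (b - t) := edist_maximalGeodesic_le hg hc p hv htb
    refine le_antisymm h1 ?_
    have hD : g.edist hg (γ s) (γ t) ≠ ⊤ := ne_top_of_le_ne_top ENNReal.ofReal_ne_top h1
    have htri : g.edist hg p (γ b) ≤ g.edist hg p (γ s) + g.edist hg (γ s) (γ t) + g.edist hg (γ t) (γ b) :=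
      calc g.edist hg p (γ b) ≤ g.edist hg p (γ t) + g.edist hg (γ t) (γ b) := g.edist_triangle hg _ _ _
        _ ≤ g.edist hg p (γ s) + g.edist hg (γ s) (γ t) + g.edist hg (γ t) (γ b) :=
            add_le_add (g.edist_triangle hg _ _ _) le_rfl
    have h4 : ENNReal.ofReal b ≤
        ENNReal.ofReal s + g.edist hg (γ s) (γ t) + ENNReal.ofReal (b - t) := by
      rw [← hpb]; exact htri.trans (add_le_add (add_le_add h2 le_rfl) h3)
    have hfin : ENNReal.ofReal s + g.edist hg (γ s) (γ t) + ENNReal.ofReal (b - t) ≠ ⊤ := by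
      simp [hD]
    have h5 := ENNReal.toReal_mono hfin h4
    rw [ENNReal.toReal_add (by simp [hD]) ENNReal.ofReal_ne_top,
      ENNReal.toReal_add ENNReal.ofReal_ne_top hD, ENNReal.toReal_ofReal hb,
      ENNReal.toReal_ofReal hs, ENNReal.toReal_ofReal (by linarith)] at h5
    calc ENNReal.ofReal (t - s) ≤ ENNReal.ofReal (g.edist hg (γ s) (γ t)).toReal :=
          ENNReal.ofReal_le_ofReal (by linarith)
      _ = _ := ENNReal.ofReal_toReal hD
  intro s hs t ht
  rcases le_total s t with hst | hts
  · rw [key s t hs.1 hst ht.2, abs_of_nonpos (by linarith), neg_sub]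
  · rw [g.edist_comm hg, key t s ht.1 hts hs.2, abs_of_nonneg (by linarith)]

/-! ### The cut time: attained supremum, positivity -/

omit [CompleteSpace E] [T2Space M] [BoundarylessManifold I M]
  [CovariantDerivative.ContMDiffCovariantDerivative g.leviCivita 1] in
/-- `γ_v|[0,b]` minimizing with `b > 0` gives `t_cut(p, v) ≥ b` (definition of `t_cut` as a
supremum, Lee p. 307). [cite: LeeRiemannianManifolds2018, p. 307] -/
theorem ofReal_le_cutTime_of_isMinimizingUpTo (hg : g.IsRiemannian) (p : M) {v : TangentSpace I p}
    {b : ℝ} (hb : 0 < b) (h : IsMinimizingUpTo g hg p v b) :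
    ENNReal.ofReal b ≤ cutTime g hg p v :=
  le_sSup ⟨b, ⟨hb, h⟩, rfl⟩

omit [CompleteSpace E] [T2Space M] [BoundarylessManifold I M]
  [CovariantDerivative.ContMDiffCovariantDerivative g.leviCivita 1] in
/-- If `t_cut(p, v) > c ≥ 0` then `γ_v` minimizes on some `[0, b]` with `b > c` (definition of
`t_cut` as a supremum). [cite: LeeRiemannianManifolds2018, p. 307] -/
theorem exists_isMinimizingUpTo_of_ofReal_lt_cutTime (hg : g.IsRiemannian) (p : M)
    {v : TangentSpace I p} {c : ℝ} (hc0 : 0 ≤ c) (h : ENNReal.ofReal c < cutTime g hg p v) :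
    ∃ b : ℝ, c < b ∧ IsMinimizingUpTo g hg p v b := by
  obtain ⟨x, ⟨b, ⟨-, hb⟩, rfl⟩, hcx⟩ := lt_sSup_iff.1 h
  exact ⟨b, (ENNReal.ofReal_lt_ofReal_iff_of_nonneg hc0).1 hcx, hb⟩

/-- **The set of `(v, b)` with `γ_v|[0,b]` minimizing is closed** in `T_pM × ℝ` (the
"minimizing" condition `L(γ_v|[0,b]) = b|v| = d(p, exp_p(bv))` is an equation between
continuous functions of `(v, b)`: continuity of `exp_p`, Lee Prop. 5.19, and of `d`). This is the
easy half of the continuity of `t_cut` (Lee, Thm. 10.33, "`γ_v|[0,c]` is minimizing by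
continuity of the distance function"). [cite: LeeRiemannianManifolds2018, Prop. 10.32 (b) (proof)] -/
theorem isClosed_setOf_isMinimizingUpTo (hn : (∞ : ℕ∞ω) ≤ n) (hg : g.IsRiemannian)
    (hc : IsGeodesicallyComplete g.leviCivita) (p : M) :
    IsClosed {q : E × ℝ | IsMinimizingUpTo g hg p (show TangentSpace I p from q.1) q.2} := by
  haveI : Fact (1 ≤ n) := ⟨le_trans (by exact_mod_cast le_top) hn⟩
  haveI := Manifold.locallyCompact_of_finiteDimensional (M := M) I
  set G : E →L[ℝ] E →L[ℝ] ℝ := g.val p with hG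
  have hexp : Continuous fun w : E ↦ riemannianExpMap g p (show TangentSpace I p from w) :=
    (contMDiff_riemannianExpMap g hn hc p).continuous
  have hset : {q : E × ℝ | IsMinimizingUpTo g hg p (show TangentSpace I p from q.1) q.2} =
      {q : E × ℝ | ENNReal.ofReal (q.2 * Real.sqrt (G q.1 q.1)) =
        g.edist hg p (riemannianExpMap g p (show TangentSpace I p from q.2 • q.1))} := by
    ext ⟨w, b⟩
    simp only [mem_setOf_eq, IsMinimizingUpTo]
    rw [(maximalGeodesic_of_isGeodesicallyComplete hc p (show TangentSpace I p from w)).1,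
      length_maximalGeodesic hg hc p (show TangentSpace I p from w) 0 b, sub_zero]
    have he : riemannianExpMap g p (show TangentSpace I p from b • w) =
        maximalGeodesic g.leviCivita p (show TangentSpace I p from w) b :=
      expMap_smul hc p (show TangentSpace I p from w) b
    rw [he]
    constructor
    · rintro ⟨-, h⟩; exact h
    · intro h; exact ⟨subset_univ _, h⟩
  rw [hset]
  have h1 : Continuous fun q : E × ℝ ↦ ENNReal.ofReal (q.2 * Real.sqrt (G q.1 q.1)) := by
    refine ENNReal.continuous_ofReal.comp (continuous_snd.mul ?_)
    refine Real.continuous_sqrt.comp ?_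
    exact (G.continuous₂.comp (continuous_fst.prodMk continuous_fst))
  have h2 : Continuous fun q : E × ℝ ↦
      g.edist hg p (riemannianExpMap g p (show TangentSpace I p from q.2 • q.1)) := by
    have h3 : Continuous fun q : E × ℝ ↦ riemannianExpMap g p (show TangentSpace I p from q.2 • q.1) :=
      hexp.comp (continuous_snd.smul continuous_fst)
    exact (g.continuous_edist hg).comp (continuous_const.prodMk h3)
  exact isClosed_eq h1 h2

/-- **The supremum in `t_cut` is attained** (Lee 2018, Prop. 10.32 (b): "`γ_v|[0,c]` is
minimizing", by closedness of the minimizing condition): if `t_cut(p, v) = c` with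
`0 < c < ∞` then `γ_v|[0,c]` is minimizing. [cite: LeeRiemannianManifolds2018, Prop. 10.32 (b)] -/
theorem isMinimizingUpTo_of_cutTime_eq (hn : (∞ : ℕ∞ω) ≤ n) (hg : g.IsRiemannian)
    (hc : IsGeodesicallyComplete g.leviCivita) (p : M) {v : E} {c : ℝ} (hc0 : 0 < c)
    (hcut : cutTime g hg p (show TangentSpace I p from v) = ENNReal.ofReal c) :
    IsMinimizingUpTo g hg p (show TangentSpace I p from v) c := by
  haveI : Fact (1 ≤ n) := ⟨le_trans (by exact_mod_cast le_top) hn⟩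
  have hclosed := isClosed_setOf_isMinimizingUpTo g hn hg hc p
  -- minimizing up to `c - 1/(k+1)` for large `k`
  have hmin : ∀ b : ℝ, 0 ≤ b → b < c → IsMinimizingUpTo g hg p (show TangentSpace I p from v) b := by
    intro b hb hbc
    have hlt : ENNReal.ofReal b < cutTime g hg p (show TangentSpace I p from v) := by
      rw [hcut]; exact (ENNReal.ofReal_lt_ofReal_iff_of_nonneg hb).2 hbc
    obtain ⟨b', hbb', hb'⟩ := exists_isMinimizingUpTo_of_ofReal_lt_cutTime g hg p hb hlt
    exact hb'.mono hc hb hbb'.le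
  -- pass to the limit `b → c⁻`
  have hmem : ((show E from v), c) ∈ closure {q : E × ℝ |
      IsMinimizingUpTo g hg p (show TangentSpace I p from q.1) q.2} := by
    rw [mem_closure_iff_seq_limit]
    refine ⟨fun k : ℕ ↦ ((show E from v), c - c / (k + 2)), fun k ↦ ?_, ?_⟩
    · show IsMinimizingUpTo g hg p (show TangentSpace I p from v) (c - c / (k + 2))
      have hk : (0 : ℝ) < k + 2 := by positivity
      apply hmin
      · rw [sub_nonneg, div_le_iff₀ hk]; nlinarith
      · have : 0 < c / (k + 2) := by positivity
        linarith
    · refine Tendsto.prodMk_nhds tendsto_const_nhds ?_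
      have h1 : Tendsto (fun k : ℕ ↦ c / ((k : ℝ) + 2)) atTop (𝓝 0) := by
        have h2 : Tendsto (fun k : ℕ ↦ (k : ℝ) + 2) atTop atTop :=
          tendsto_natCast_atTop_atTop.atTop_add tendsto_const_nhds
        exact h2.const_div_atTop c
      have h3 := h1.const_sub c
      rwa [sub_zero] at h3
  exact hclosed.closure_subset hmem

/-- **The cut time is bounded below on the unit sphere** (Lee 2018, p. 308: "`t_cut(p, v) > 0`"
uniformly, since `exp_p` is a radial isometry on a normal ball, Prop. 6.11): there is `ε > 0`
with `γ_v|[0,b]` minimizing for all unit `v` and `0 ≤ b < ε`, hence `t_cut(p, v) ≥ ε`.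
[cite: LeeRiemannianManifolds2018, Prop. 6.11 and p. 308] -/
theorem exists_pos_le_cutTime (hn : (∞ : ℕ∞ω) ≤ n) (hg : g.IsRiemannian)
    (hc : IsGeodesicallyComplete g.leviCivita) (p : M) :
    ∃ ε > (0 : ℝ), ∀ v : E, g.val p (show TangentSpace I p from v) (show TangentSpace I p from v) = 1 →
      (∀ b : ℝ, 0 ≤ b → b < ε → IsMinimizingUpTo g hg p (show TangentSpace I p from v) b) ∧
        ENNReal.ofReal ε ≤ cutTime g hg p (show TangentSpace I p from v) := by
  haveI : Fact (1 ≤ n) := ⟨le_trans (by exact_mod_cast le_top) hn⟩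
  obtain ⟨ε, hε, h1, -⟩ := exists_normalBall g hn hg p
  refine ⟨ε, hε, fun v hv ↦ ?_⟩
  have hmin : ∀ b : ℝ, 0 ≤ b → b < ε → IsMinimizingUpTo g hg p (show TangentSpace I p from v) b := by
    intro b hb hbε
    rw [isMinimizingUpTo_iff_edist g hg hc p hv b]
    set G : E →L[ℝ] E →L[ℝ] ℝ := g.val p with hG
    have hsq : G (b • v) (b • v) = b ^ 2 := by
      have h3 : G (b • v) (b • v) = b * (b * G v v) := by
        simp only [map_smul, smul_apply, smul_eq_mul]
      rw [h3, show G v v = 1 from hv]; ring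
    have hlt : G (b • v) (b • v) < ε ^ 2 := by
      rw [hsq]; exact pow_lt_pow_left₀ hbε hb two_ne_zero
    have h2 : g.edist hg p (expMap g.leviCivita p (show TangentSpace I p from b • v)) =
        ENNReal.ofReal (Real.sqrt (b ^ 2)) := by
      rw [← hsq]; exact (h1 (show TangentSpace I p from b • v) hlt).2
    rw [Real.sqrt_sq hb] at h2
    rw [← expMap_smul hc p (show TangentSpace I p from v) b]
    exact h2
  refine ⟨hmin, ?_⟩
  by_contra hlt
  push Not at hlt
  obtain ⟨b, -, hb1, hb2⟩ := ENNReal.lt_iff_exists_real_btwn.1 hlt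
  have hb0 : 0 < b := by
    have : (0 : ℝ≥0∞) < ENNReal.ofReal b := lt_of_le_of_lt bot_le hb1
    exact ENNReal.ofReal_pos.1 this
  have hbε : b < ε := (ENNReal.ofReal_lt_ofReal_iff hε).1 hb2
  exact absurd (ofReal_le_cutTime_of_isMinimizingUpTo g hg p hb0 (hmin b hb0.le hbε)) (not_le.2 hb1)

/-! ### A geodesic through an initial piece of a metric segment contains the segment -/

/-- **A geodesic which agrees with a unit-speed metric segment `τ` (on `[0, ℓ]`) on an initial
interval `[0, δ]`, `δ > 0`, agrees with `τ` on `[0, ℓ]`** — since `τ` is itself a geodesic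
(`segment_eq_maximalGeodesic`, Lee Thm. 6.4 / Cor. 6.12) and geodesics are determined by their
germ at one time (`IsGeodesicOn.eqOn_of_velocity_eq_holds`).
[cite: LeeRiemannianManifolds2018, Thm. 6.4 and Prop. 10.32 (a) (proof)] -/
theorem eqOn_of_isGeodesic_of_segment (hn : (∞ : ℕ∞ω) ≤ n) (hg : g.IsRiemannian)
    (hc : IsGeodesicallyComplete g.leviCivita) {τ γ : ℝ → M} {ℓ δ : ℝ} (hδ : 0 < δ) (hδℓ : δ ≤ ℓ)
    (hτ : ∀ s ∈ Icc 0 ℓ, ∀ t ∈ Icc 0 ℓ, g.edist hg (τ s) (τ t) = ENNReal.ofReal |s - t|)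
    (hγ : IsGeodesic g.leviCivita γ) (heq : EqOn γ τ (Icc 0 δ)) : EqOn γ τ (Icc 0 ℓ) := by
  set t₁ : ℝ := δ / 2 with ht₁_def
  have ht₁ : t₁ ∈ Ioo 0 ℓ := ⟨by simp only [ht₁_def]; positivity, by simp only [ht₁_def]; linarith⟩
  obtain ⟨a, -, hτa⟩ := segment_eq_maximalGeodesic g hn hg hc hτ ht₁
  set Ψa := maximalGeodesic g.leviCivita (τ t₁) (show TangentSpace I (τ t₁) from a) with hΨa
  set Ψ : ℝ → M := maximalGeodesic g.leviCivita (Ψa (-t₁)) (velocity I Ψa (-t₁)) with hΨ_def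
  have hΨ_eq : ∀ t, Ψ t = Ψa (t - t₁) := fun t ↦ by
    rw [hΨ_def, maximalGeodesic_velocity_apply hc, sub_eq_add_neg]
  have hΨgeod : IsGeodesic g.leviCivita Ψ :=
    (maximalGeodesic_of_isGeodesicallyComplete hc (Ψa (-t₁)) (velocity I Ψa (-t₁))).2.1
  -- `γ` and `Ψ` agree near `t₁`
  have hnear : γ =ᶠ[𝓝 t₁] Ψ := by
    have hIoo : Ioo 0 δ ∈ 𝓝 t₁ :=
      Ioo_mem_nhds (by simp only [ht₁_def]; positivity) (by simp only [ht₁_def]; linarith)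
    filter_upwards [hIoo] with t ht
    rw [heq ⟨ht.1.le, ht.2.le⟩, hΨ_eq, hτa t ⟨ht.1.le, ht.2.le.trans hδℓ⟩]
  have hpt : γ t₁ = Ψ t₁ := hnear.eq_of_nhds
  have hvel : velocity I γ t₁ = velocity I Ψ t₁ := velocity_congr_of_eventuallyEq hnear
  have hall := IsGeodesicOn.eqOn_of_velocity_eq_holds (cov := g.leviCivita) isOpen_univ
    ordConnected_univ (hγ.isGeodesicOn univ) (hΨgeod.isGeodesicOn univ) (mem_univ t₁) hpt hvel
  intro t ht
  rw [hall (mem_univ t), hΨ_eq, hτa t ht]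

/-! ### The metric cut locus is the set of cut points -/

section CutLocus

variable [ConnectedSpace M]

/-- **A metric cut point of `p` is the cut point along a minimizing geodesic from `p`**
(Lee 2018, p. 308 with the Hopf–Rinow theorem, Lemma 6.18 / Cor. 6.21): if `q ∈ cutLocus g hg p`
then `q = γ_v(c)` for a `g_p`-unit vector `v` and `c = d(p, q) > 0` with `t_cut(p, v) = c`
(`γ_v|[0,c]` is a minimizing segment from `p` to `q`; if `γ_v` minimized up to `b > c`, the
point `r = γ_v(b)` would satisfy `d(p, r) = d(p, q) + d(q, r)` with `r ≠ q`).
[cite: LeeRiemannianManifolds2018, p. 308 and Cor. 6.21] -/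
theorem exists_unit_cutTime_eq_of_mem_cutLocus (hn : (∞ : ℕ∞ω) ≤ n) (hg : g.IsRiemannian)
    (hc : IsGeodesicallyComplete g.leviCivita) (p : M) {q : M} (hq : q ∈ cutLocus g hg p) :
    ∃ (v : E) (c : ℝ), g.val p (show TangentSpace I p from v) (show TangentSpace I p from v) = 1 ∧
      0 < c ∧ cutTime g hg p (show TangentSpace I p from v) = ENNReal.ofReal c ∧
      maximalGeodesic g.leviCivita p (show TangentSpace I p from v) c = q ∧
      g.edist hg p q = ENNReal.ofReal c := by
  haveI : Fact (1 ≤ n) := ⟨le_trans (by exact_mod_cast le_top) hn⟩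
  obtain ⟨hqp, hcut⟩ := hq
  obtain ⟨u, hmin, hexp⟩ := exists_isMinimizingUpTo_of_isGeodesicallyComplete g hn hg hc p q
  have hu0 : (show E from u) ≠ 0 := by
    intro h0
    apply hqp
    rw [← hexp]
    have : u = (0 : TangentSpace I p) := h0
    rw [this]
    exact riemannianExpMap_zero g p
  have hGu : 0 < g.val p u u := hg p u hu0
  set c : ℝ := Real.sqrt (g.val p u u) with hc_def
  have hc0 : 0 < c := Real.sqrt_pos.2 hGu
  have hcsq : c ^ 2 = g.val p u u := Real.sq_sqrt hGu.le
  set v : TangentSpace I p := c⁻¹ • u with hv_def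
  have hv : g.val p v v = 1 := by
    simp only [hv_def, map_smul, smul_apply, smul_eq_mul, ← hcsq]
    field_simp
  -- `γ_v(c) = γ_u(1) = q` and `γ_v|[0,c]` is minimizing
  have hγvc : maximalGeodesic g.leviCivita p v c = q := by
    have h1 := maximalGeodesic_smul hc p u c⁻¹ c
    rw [inv_mul_cancel₀ hc0.ne'] at h1
    rw [← hexp, show riemannianExpMap g p u = expMap g.leviCivita p u from rfl,
      expMap_eq_maximalGeodesic hc]
    exact h1
  have hminv : IsMinimizingUpTo g hg p v c := by
    have h1 := (isMinimizingUpTo_smul_iff hg hc p u (inv_pos.2 hc0) c).2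
    rw [inv_mul_cancel₀ hc0.ne'] at h1
    exact h1 hmin
  have hdpq : g.edist hg p q = ENNReal.ofReal c := by
    rw [← hγvc]; exact (isMinimizingUpTo_iff_edist g hg hc p hv c).1 hminv
  refine ⟨v, c, hv, hc0, ?_, hγvc, hdpq⟩
  refine le_antisymm ?_ (ofReal_le_cutTime_of_isMinimizingUpTo g hg p hc0 hminv)
  by_contra hlt
  push Not at hlt
  obtain ⟨b, hcb, hb⟩ := exists_isMinimizingUpTo_of_ofReal_lt_cutTime g hg p hc0.le hlt
  set r := maximalGeodesic g.leviCivita p v b with hr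
  have hdpr : g.edist hg p r = ENNReal.ofReal b :=
    (isMinimizingUpTo_iff_edist g hg hc p hv b).1 hb
  have hdqr : g.edist hg q r = ENNReal.ofReal (b - c) := by
    rw [← hγvc, hr]
    have h := edist_maximalGeodesic_eq_of_isMinimizingUpTo g hg hc p hv hb c ⟨hc0.le, hcb.le⟩ b
      ⟨hc0.le.trans hcb.le, le_rfl⟩
    rw [h, abs_of_nonpos (by linarith), neg_sub]
  have hsum : g.edist hg p r = g.edist hg p q + g.edist hg q r := by
    rw [hdpr, hdpq, hdqr, ← ENNReal.ofReal_add hc0.le (by linarith)]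
    congr 1; ring
  have hrq : r = q := hcut r hsum
  rw [hrq, hdpq] at hdpr
  have := (ENNReal.ofReal_eq_ofReal_iff hc0.le (hc0.le.trans hcb.le)).1 hdpr
  linarith

/-- **The cut point along `γ_v` is a metric cut point** (Lee 2018, p. 308: for `t > t_cut`,
`γ_v|[0,t]` is no longer minimizing; Hopf–Rinow at `q`): for a `g_p`-unit vector `v` with
`t_cut(p, v) = c`, `0 < c < ∞`, the point `q = γ_v(c)` lies in `cutLocus g hg p`. Indeed
`d(p, q) = c > 0`; and if `d(p, r) = d(p, q) + d(q, r)` with `r ≠ q`, a minimizing geodesic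
from `q` to `r` (Cor. 6.21) concatenated with `γ_v|[0,c]` is a unit-speed metric segment from
`p`, hence coincides with `γ_v` (`eqOn_of_isGeodesic_of_segment`), so `γ_v` would minimize
beyond `c`. [cite: LeeRiemannianManifolds2018, p. 308 and Cor. 6.21] -/
theorem maximalGeodesic_mem_cutLocus_of_cutTime_eq (hn : (∞ : ℕ∞ω) ≤ n) (hg : g.IsRiemannian)
    (hc : IsGeodesicallyComplete g.leviCivita) (p : M) {v : E} {c : ℝ}
    (hv : g.val p (show TangentSpace I p from v) (show TangentSpace I p from v) = 1) (hc0 : 0 < c)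
    (hcut : cutTime g hg p (show TangentSpace I p from v) = ENNReal.ofReal c) :
    maximalGeodesic g.leviCivita p (show TangentSpace I p from v) c ∈ cutLocus g hg p := by
  haveI : Fact (1 ≤ n) := ⟨le_trans (by exact_mod_cast le_top) hn⟩
  haveI := Manifold.locallyCompact_of_finiteDimensional (M := M) I
  set γ := maximalGeodesic g.leviCivita p (show TangentSpace I p from v) with hγ_def
  obtain ⟨-, hγgeod, hγ0, -⟩ := maximalGeodesic_of_isGeodesicallyComplete hc p (show TangentSpace I p from v)
  have hmin : IsMinimizingUpTo g hg p (show TangentSpace I p from v) c :=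
    isMinimizingUpTo_of_cutTime_eq g hn hg hc p hc0 hcut
  have hdpq : g.edist hg p (γ c) = ENNReal.ofReal c := (isMinimizingUpTo_iff_edist g hg hc p hv c).1 hmin
  have hseg₁ := edist_maximalGeodesic_eq_of_isMinimizingUpTo g hg hc p hv hmin
  refine ⟨fun h ↦ ?_, fun r hr ↦ ?_⟩
  · rw [h, g.edist_self hg] at hdpq
    exact absurd hdpq.symm (ENNReal.ofReal_pos.2 hc0).ne'
  -- a minimizing geodesic from `q = γ c` to `r`
  obtain ⟨u, hminu, hexpu⟩ := exists_isMinimizingUpTo_of_isGeodesicallyComplete g hn hg hc (γ c) r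
  by_cases hu0 : u = 0
  · rw [hu0, riemannianExpMap_zero] at hexpu
    exact hexpu.symm
  exfalso
  have hGu : 0 < g.val (γ c) u u := hg (γ c) u hu0
  set e' : ℝ := Real.sqrt (g.val (γ c) u u) with he'_def
  have he'0 : 0 < e' := Real.sqrt_pos.2 hGu
  have he'sq : e' ^ 2 = g.val (γ c) u u := Real.sq_sqrt hGu.le
  set w : TangentSpace I (γ c) := e'⁻¹ • u with hw_def
  have hw : g.val (γ c) w w = 1 := by
    simp only [hw_def, map_smul, smul_apply, smul_eq_mul, ← he'sq]
    field_simp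
  set γw := maximalGeodesic g.leviCivita (γ c) w with hγw_def
  have hγwe' : γw e' = r := by
    have h1 := maximalGeodesic_smul hc (γ c) u e'⁻¹ e'
    rw [inv_mul_cancel₀ he'0.ne'] at h1
    rw [← hexpu, show riemannianExpMap g (γ c) u = expMap g.leviCivita (γ c) u from rfl,
      expMap_eq_maximalGeodesic hc]
    exact h1
  have hminw : IsMinimizingUpTo g hg (γ c) w e' := by
    have h1 := (isMinimizingUpTo_smul_iff hg hc (γ c) u (inv_pos.2 he'0) e').2
    rw [inv_mul_cancel₀ he'0.ne'] at h1
    exact h1 hminu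
  have he : g.edist hg (γ c) r = ENNReal.ofReal e' := by
    have h1 := (isMinimizingUpTo_iff_edist g hg hc (γ c) hw e').1 hminw
    change g.edist hg (γ c) (γw e') = ENNReal.ofReal e' at h1
    rwa [hγwe'] at h1
  have hseg₂ : ∀ s ∈ Icc 0 e', ∀ t ∈ Icc 0 e', g.edist hg (γw s) (γw t) = ENNReal.ofReal |s - t| :=
    edist_maximalGeodesic_eq_of_isMinimizingUpTo g hg hc (γ c) hw hminw
  have hγw0 : γw 0 = γ c := (maximalGeodesic_of_isGeodesicallyComplete hc (γ c) w).2.2.1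
  -- the concatenated segment
  have hγ0' : γ 0 = p := hγ0
  have hadd : g.edist hg (γ 0) (γw e') = ENNReal.ofReal (c + e') := by
    rw [hγ0', hγwe', hr, hdpq, he, ENNReal.ofReal_add hc0.le he'0.le]
  obtain ⟨τ, hτ₁, hτ₂, hτ⟩ := unitSpeed_segment_concat hg hc0.le he'0.le hseg₁ hseg₂ hγw0.symm hadd
  -- `γ` agrees with `τ` on `[0, c]`, hence on `[0, c + e']`
  have heqOn : EqOn γ τ (Icc 0 c) := fun t ht ↦ (hτ₁ ht).symm
  have hall := eqOn_of_isGeodesic_of_segment g hn hg hc hc0 (by linarith) hτ hγgeod heqOn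
  have hγce : γ (c + e') = r := by
    have h1 : γ (c + e') = τ (c + e') := hall ⟨by linarith, le_rfl⟩
    have h2 : τ (c + e') = γw (c + e' - c) := hτ₂ (c + e') ⟨by linarith, le_rfl⟩
    rw [h1, h2, add_sub_cancel_left, hγwe']
  -- so `γ_v` minimizes up to `c + e' > c = t_cut`
  have hmin' : IsMinimizingUpTo g hg p (show TangentSpace I p from v) (c + e') := by
    rw [isMinimizingUpTo_iff_edist g hg hc p hv (c + e')]
    show g.edist hg p (γ (c + e')) = ENNReal.ofReal (c + e')
    rw [hγce, hr, hdpq, he, ENNReal.ofReal_add hc0.le he'0.le]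
  have hle := ofReal_le_cutTime_of_isMinimizingUpTo g hg p (by linarith) hmin'
  rw [hcut] at hle
  have := (ENNReal.ofReal_le_ofReal_iff hc0.le).1 hle
  linarith

/-- **Closedness of the cut locus from lower semicontinuity of the cut time** (the proof of
Lee 2018, Thm. 10.34 (a), p. 311). Suppose that for unit vectors `v_i → v` at `p` with finite cut
times `t_cut(p, v_i) = c_i → c` one always has `t_cut(p, v) ≤ c` (the hard half of the continuity
of `t_cut`, Lee Thm. 10.33, resting on Thm. 10.26). Then `cutLocus g hg p` is closed: for cut
points `q_i → q`, `q_i = γ_{v_i}(c_i)` with `c_i = d(p, q_i) → d(p, q) = c > 0`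
(`exists_pos_le_cutTime`), a subsequence `v_i → v` (compactness of the unit sphere),
`γ_v|[0,c]` is minimizing (`isClosed_setOf_isMinimizingUpTo`) so `t_cut(p, v) = c`, and
`q = γ_v(c)` is the cut point along `γ_v` (`maximalGeodesic_mem_cutLocus_of_cutTime_eq`).
[cite: LeeRiemannianManifolds2018, Thm. 10.34 (a)] -/
theorem isClosed_cutLocus_of_cutTime_le (hn : (∞ : ℕ∞ω) ≤ n) (hg : g.IsRiemannian)
    (hc : IsGeodesicallyComplete g.leviCivita) (p : M)
    (hLSC : ∀ (v : ℕ → E) (c : ℕ → ℝ) (v₀ : E) (c₀ : ℝ),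
      (∀ i, g.val p (show TangentSpace I p from v i) (show TangentSpace I p from v i) = 1) →
      (∀ i, 0 < c i) →
      (∀ i, cutTime g hg p (show TangentSpace I p from v i) = ENNReal.ofReal (c i)) →
      Tendsto v atTop (𝓝 v₀) → Tendsto c atTop (𝓝 c₀) →
      cutTime g hg p (show TangentSpace I p from v₀) ≤ ENNReal.ofReal c₀) :
    IsClosed (cutLocus g hg p) := by
  haveI : Fact (1 ≤ n) := ⟨le_trans (by exact_mod_cast le_top) hn⟩
  haveI := Manifold.locallyCompact_of_finiteDimensional (M := M) I
  have hexp : Continuous fun w : E ↦ riemannianExpMap g p (show TangentSpace I p from w) :=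
    (contMDiff_riemannianExpMap g hn hc p).continuous
  obtain ⟨ε, hε, hεcut⟩ := exists_pos_le_cutTime g hn hg hc p
  refine closure_subset_iff_isClosed.1 fun q hq ↦ ?_
  -- a sequence of cut points `y k → q`
  have hy : ∀ k : ℕ, ∃ y ∈ cutLocus g hg p, g.edist hg q y < ENNReal.ofReal (1 / ((k : ℝ) + 1)) := by
    intro k
    have hU : {y | g.edist hg q y < ENNReal.ofReal (1 / ((k : ℝ) + 1))} ∈ 𝓝 q :=
      g.setOf_edist_lt_mem_nhds hg q (ENNReal.ofReal_pos.2 (by positivity))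
    obtain ⟨y, hyU, hyC⟩ := mem_closure_iff_nhds.1 hq _ hU
    exact ⟨y, hyC, hyU⟩
  choose y hyC hyd using hy
  have hyq : Tendsto y atTop (𝓝 q) := by
    rw [(g.nhds_hasBasis_edist hg q).tendsto_right_iff]
    intro r hr
    have h0 : Tendsto (fun k : ℕ ↦ ENNReal.ofReal (1 / ((k : ℝ) + 1))) atTop (𝓝 0) := by
      have h1 : Tendsto (fun k : ℕ ↦ 1 / ((k : ℝ) + 1)) atTop (𝓝 0) := tendsto_one_div_add_atTop_nhds_zero_nat
      have h2 := (ENNReal.continuous_ofReal.tendsto 0).comp h1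
      rwa [ENNReal.ofReal_zero] at h2
    filter_upwards [h0.eventually (gt_mem_nhds hr)] with k hk
    exact (hyd k).trans hk
  -- the data of each cut point
  have hdata := fun k ↦ exists_unit_cutTime_eq_of_mem_cutLocus g hn hg hc p (hyC k)
  choose v c hv hc0 hcut hγ hd using hdata
  -- `c k → c₀ = d(p, q)`, `c₀ ≥ ε > 0`
  have hfin : g.edist hg p q ≠ ⊤ := g.edist_ne_top hg p q
  set c₀ : ℝ := (g.edist hg p q).toReal with hc₀_def
  have hcc₀ : Tendsto c atTop (𝓝 c₀) := by
    have h1 : Tendsto (fun k ↦ g.edist hg p (y k)) atTop (𝓝 (g.edist hg p q)) :=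
      ((g.continuous_edist hg).comp (continuous_const.prodMk continuous_id)).continuousAt.tendsto.comp hyq
    have h2 := (ENNReal.tendsto_toReal hfin).comp h1
    refine h2.congr fun k ↦ ?_
    simp only [Function.comp_apply, hd k, ENNReal.toReal_ofReal (hc0 k).le]
  have hcε : ∀ k, ε ≤ c k := fun k ↦ by
    have h1 := (hεcut (v k) (hv k)).2
    rw [hcut k] at h1
    exact (ENNReal.ofReal_le_ofReal_iff (hc0 k).le).1 h1
  have hc₀ε : ε ≤ c₀ := ge_of_tendsto' hcc₀ hcε
  have hc₀0 : 0 < c₀ := hε.trans_le hc₀ε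
  -- a convergent subsequence of the unit vectors
  obtain ⟨v₀, hv₀, φ, hφ, hvφ⟩ := (isCompact_setOf_val_eq_one g hg p).tendsto_subseq (fun k ↦ hv k)
  have hcφ : Tendsto (c ∘ φ) atTop (𝓝 c₀) := hcc₀.comp hφ.tendsto_atTop
  -- lower semicontinuity (hypothesis) and upper semicontinuity (closedness of minimizing)
  have hle : cutTime g hg p (show TangentSpace I p from v₀) ≤ ENNReal.ofReal c₀ :=
    hLSC (v ∘ φ) (c ∘ φ) v₀ c₀ (fun i ↦ hv (φ i)) (fun i ↦ hc0 (φ i)) (fun i ↦ hcut (φ i)) hvφ hcφ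
  have hminlim : IsMinimizingUpTo g hg p (show TangentSpace I p from v₀) c₀ := by
    have hclosed := isClosed_setOf_isMinimizingUpTo g hn hg hc p
    have hmem : ∀ k, ((v (φ k)), c (φ k)) ∈ {q : E × ℝ |
        IsMinimizingUpTo g hg p (show TangentSpace I p from q.1) q.2} := fun k ↦
      isMinimizingUpTo_of_cutTime_eq g hn hg hc p (hc0 (φ k)) (hcut (φ k))
    exact hclosed.mem_of_tendsto (hvφ.prodMk_nhds hcφ) (Eventually.of_forall hmem)
  have hge : ENNReal.ofReal c₀ ≤ cutTime g hg p (show TangentSpace I p from v₀) :=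
    ofReal_le_cutTime_of_isMinimizingUpTo g hg p hc₀0 hminlim
  have hcut₀ : cutTime g hg p (show TangentSpace I p from v₀) = ENNReal.ofReal c₀ := le_antisymm hle hge
  -- `q = γ_{v₀}(c₀)`
  have hq₀ : maximalGeodesic g.leviCivita p (show TangentSpace I p from v₀) c₀ = q := by
    have h1 : Tendsto (fun k ↦ riemannianExpMap g p (show TangentSpace I p from c (φ k) • v (φ k)))
        atTop (𝓝 (riemannianExpMap g p (show TangentSpace I p from c₀ • v₀))) :=
      (hexp.tendsto _).comp (hcφ.smul hvφ)
    have h2 : Tendsto (fun k ↦ riemannianExpMap g p (show TangentSpace I p from c (φ k) • v (φ k)))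
        atTop (𝓝 q) := by
      refine (hyq.comp hφ.tendsto_atTop).congr fun k ↦ ?_
      simp only [Function.comp_apply]
      rw [← hγ (φ k)]
      exact (expMap_smul hc p (show TangentSpace I p from v (φ k)) (c (φ k))).symm
    rw [← expMap_smul hc p (show TangentSpace I p from v₀) c₀]
    exact tendsto_nhds_unique h1 h2
  rw [← hq₀]
  exact maximalGeodesic_mem_cutLocus_of_cutTime_eq g hn hg hc p hv₀ hc₀0 hcut₀

end CutLocus

end Literature.Geometry.Riemannian
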